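import Literature.NumberTheory.LFunctions.WeilSemilocalCompactness
import Literature.Analysis.SpecialFunctions.DigammaVerticalAsymptotics
import Mathlib.Analysis.SpecialFunctions.Trigonometric.Bounds
import HarnessLib

/-!
# The semilocal Weil form has discrete spectrum: proof of Connes–Consani–Moscovici 2025, Thm. 3.6

Sibling proof file of `Literature/NumberTheory/LFunctions/WeilSemilocalCompactness.lean` (same
normalisation: additive variable, window `[-a, a]`, test functions `IsWeilTest`,
`ĝ(s) = weilMellin g s`, `Q(g) = weilQuadratic g = W(g ⋆ g̃)`). It DISCHARGES the named fact
`Literature.NumberTheory.LFunctions.ConnesConsaniMoscovici2025_thm_3_6` — the sequential form of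
the compactness of the form-norm embedding (Connes–Consani–Moscovici, *Zeta spectral triples*,
arXiv:2511.22755, Thm. 3.6 with Prop. 3.5 (1)⇔(4) = Schmüdgen Prop. 10.6): every `L²`-normalised
sequence of test functions on the window with bounded form values has an `L²`-convergent
subsequence.

## The printed proof (§3.2, pp. 9–10) and how it is mirrored

1. "By the proof of the lower boundedness in [4], the contribution of the non-archimedean primes
   to the operator `A_λ` is bounded as well as the contribution of the evaluation of the Fourier
   transform at the poles." Here: `weilArchIntegral_le_weilQuadratic_re` — with the three-term
   decomposition of `Q(g)` already in the tree (`weilPolarTerm_weilConv_weilReflect`,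
   `Yoshida1992_polar_lower_bound`, `norm_weilPrimeTerm_le_of_tsupport_subset`,
   `weilArchIntegral_weilConv_weilReflect`), a bound `Re Q(gₙ) ≤ B` gives a uniform bound on the
   weighted integrals `∫ |ĝₙ(1/2+it)|² Re ψ(1/4+it/2) dt`.
2. "It is given, after Fourier transform, by the multiplication by
   `∂_t θ(t) = ½(log|t| − log 2 − log π) − … ` (3.24)": the weight tends to `+∞`,
   `exists_le_reDigammaQuarter_of_le_abs` (from `ψ(1/4 + iy) = log(1+|y|) + O(1)`,
   `Literature.Analysis.SpecialFunctions.Complex.exists_norm_digamma_sub_log_le_of_pos`).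
3. The compactness of the embedding `D_ρ → L²[-L, L]` for a weight `ρ → ∞`: the tail estimate
   (3.26) `∫_{|t|≥T} |f̂|² ≤ (ε/4)²` uniformly on the unit ball of `D_ρ`, a finite `ε/2`-net on
   `|t| ≤ T`, and the assembly `‖f − f_j‖² = ∫_{|t|≤T} + ∫_{|t|≥T} < ε²` (Plancherel). Here:
   `two_pi_mul_integral_norm_sub_sq_le` (tail + window, via Plancherel
   `integral_norm_sq_weilMellin_half_line`) and the main theorem. DEVIATION: the paper obtains the
   finite net on `|t| ≤ T` from the compactness of the operator `P̂_T P_L` on `L²(ℝ)`; we obtain it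
   instead from the elementary facts that the transforms `ĝₙ(1/2+it)` of `L²`-normalised functions
   on the compact window are uniformly bounded (`norm_weilMellin_half_line_le_sqrt`) and uniformly
   Lipschitz (`norm_weilMellin_half_line_sub_le`), so that their values on a finite grid of
   `[-T, T]` (`exists_grid_point_near`) determine `gₙ` up to `ε` in `L²`; total boundedness then
   follows from the boundedness of these finitely many coordinates (`totallyBounded_of_fin_coord`),
   the closure in the complete space `L²(ℝ)` is compact, and a subsequence converges
   (`IsCompact.tendsto_subseq`).

Everything here is proved; there are no named facts and no new definitions.

## References

* A. Connes, C. Consani, H. Moscovici, *Zeta spectral triples*, arXiv:2511.22755 (2025), §3.2: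
  Prop. 3.5, Thm. 3.6 and its proof (eqs. (3.24)–(3.26)). (key `ConnesConsaniMoscovici2025`)
* K. Schmüdgen, *Unbounded self-adjoint operators on Hilbert space*, GTM 265 (2012), Prop. 10.6.
* E. Bombieri, *Remarks on Weil's quadratic functional in the theory of prime numbers I*, Rend.
  Mat. Acc. Lincei (9) 11 (2000), §4 Lemma 3 (boundedness of the polar and prime terms).
-/

noncomputable section

open Complex Filter Set MeasureTheory
open scoped Real Topology ComplexConjugate ArithmeticFunction.vonMangoldt

namespace Literature.NumberTheory.LFunctions

open Literature.Analysis.SpecialFunctions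

variable {g h : ℝ → ℂ}

/-! ## Test functions: differences, and `ĝ` on the critical line -/

/-- Test functions form a vector space: differences (a `private` copy of `IsWeilTest.sub` of
`WeilWindowSuzukiContinuityProofs.lean`, not imported to keep this file's imports light). [folklore] -/
private theorem IsWeilTest.sub_test (hg : IsWeilTest g) (hh : IsWeilTest h) : IsWeilTest (g - h) :=
  ⟨hg.1.sub hh.1, hg.2.sub hh.2⟩

/-- `(g - h)^ = ĝ - ĥ` for test functions `g, h` (a `private` copy of `weilMellin_sub` of
`WeilWindowSuzukiContinuityProofs.lean`). [folklore] -/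
private theorem weilMellin_sub_of_isWeilTest (hg : IsWeilTest g) (hh : IsWeilTest h) (s : ℂ) :
    weilMellin (g - h) s = weilMellin g s - weilMellin h s := by
  have e : g - h = g + fun t ↦ (-1 : ℂ) * h t := by
    funext t; simp [sub_eq_add_neg]
  rw [e, weilMellin_add hg.1.continuous hg.2 (hh.const_mul (-1)).1.continuous (hh.const_mul (-1)).2,
    weilMellin_const_mul]
  ring

/-- `ĝ(1/2 + it) = ∫ g(x) e^{itx} dx`. [folklore] -/
theorem weilMellin_half_line_eq (g : ℝ → ℂ) (t : ℝ) :
    weilMellin g (1 / 2 + t * I) = ∫ x : ℝ, g x * cexp (t * I * x) := by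
  rw [add_comm, weilMellin_add_half]

/-- **Uniform bound on the critical line**: `‖ĝ(1/2 + it)‖ ≤ √(2a · ‖g‖₂²)` for
`tsupport g ⊆ [-a, a]` (`‖ĝ‖_∞ ≤ ‖g‖₁ ≤ √(2a) ‖g‖₂`, Cauchy–Schwarz). [folklore] -/
theorem norm_weilMellin_half_line_le_sqrt (hg : IsWeilTest g) {a : ℝ} (ha : 0 < a)
    (hsupp : tsupport g ⊆ Icc (-a) a) (t : ℝ) :
    ‖weilMellin g (1 / 2 + t * I)‖ ≤ Real.sqrt (2 * a * ∫ x : ℝ, ‖g x‖ ^ 2) := by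
  refine (norm_weilMellin_half_line_le hg t).trans ?_
  have h := weilNorm1_sq_le hg ha hsupp
  exact (le_abs_self _).trans (Real.abs_le_sqrt h)

/-- **Uniform Lipschitz bound on the critical line**: for `tsupport g ⊆ [-a, a]`,
`‖ĝ(1/2 + it) − ĝ(1/2 + is)‖ ≤ a |t − s| ‖g‖₁` (`|e^{itx} − e^{isx}| ≤ |t − s| |x| ≤ a |t − s|` on
the support). [folklore] -/
theorem norm_weilMellin_half_line_sub_le (hg : IsWeilTest g) {a : ℝ}
    (hsupp : tsupport g ⊆ Icc (-a) a) (t s : ℝ) :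
    ‖weilMellin g (1 / 2 + t * I) - weilMellin g (1 / 2 + s * I)‖ ≤
      a * |t - s| * weilNorm1 g := by
  rw [weilMellin_half_line_eq, weilMellin_half_line_eq,
    ← integral_sub (hg.integrable_mul (by fun_prop)) (hg.integrable_mul (by fun_prop))]
  have hpt : ∀ x : ℝ, ‖g x * cexp (t * I * x) - g x * cexp (s * I * x)‖ ≤
      a * |t - s| * ‖g x‖ := by
    intro x
    by_cases hx : x ∈ Icc (-a) a
    · have e1 : g x * cexp (t * I * x) - g x * cexp (s * I * x) =
          g x * (cexp (s * I * x) * (cexp (I * (((t - s) * x : ℝ) : ℂ)) - 1)) := by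
        rw [mul_sub, mul_one, ← Complex.exp_add, ← mul_sub]
        congr 2
        push_cast
        ring
      rw [e1, norm_mul, norm_mul, Complex.norm_exp]
      have hre : ((s : ℂ) * I * (x : ℂ)).re = 0 := by simp
      rw [hre, Real.exp_zero, one_mul, mul_comm]
      refine mul_le_mul_of_nonneg_right ?_ (norm_nonneg _)
      refine (Real.norm_exp_I_mul_ofReal_sub_one_le).trans ?_
      rw [Real.norm_eq_abs, abs_mul, mul_comm a]
      exact mul_le_mul_of_nonneg_left (abs_le.2 ⟨hx.1, hx.2⟩) (abs_nonneg _)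
    · rw [eq_zero_of_tsupport_subset hsupp hx]
      simp only [zero_mul, sub_self, norm_zero, mul_zero, le_refl]
  calc ‖∫ x : ℝ, (g x * cexp (t * I * x) - g x * cexp (s * I * x))‖
      ≤ ∫ x : ℝ, ‖g x * cexp (t * I * x) - g x * cexp (s * I * x)‖ :=
        norm_integral_le_integral_norm _
    _ ≤ ∫ x : ℝ, a * |t - s| * ‖g x‖ := by
        refine integral_mono_of_nonneg (Eventually.of_forall fun _ ↦ norm_nonneg _) ?_
          (Eventually.of_forall hpt)
        exact ((hg.1.continuous.norm).integrable_of_hasCompactSupport hg.2.norm).const_mul _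
    _ = a * |t - s| * weilNorm1 g := by rw [integral_const_mul]; rfl

/-! ## The archimedean weight tends to `+∞` -/

/-- **Growth of the archimedean weight** (CCM25 (3.24): `∂_t θ(t) = ½ log|t| + O(1)`; here from
`ψ(1/4 + iy) = log(1 + |y|) + O(1)`, `Literature.Analysis.SpecialFunctions.Complex.exists_norm_digamma_sub_log_le_of_pos`):
for every level `L` there is `T > 0` with `Re ψ(1/4 + it/2) ≥ L` for `|t| ≥ T`. [cite: ConnesConsaniMoscovici2025, §3.2 eq. (3.24)] -/
theorem exists_le_reDigammaQuarter_of_le_abs (L : ℝ) :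
    ∃ T : ℝ, 0 < T ∧ ∀ t : ℝ, T ≤ |t| → L ≤ reDigammaQuarter t := by
  obtain ⟨C, hC⟩ :=
    Literature.Analysis.SpecialFunctions.Complex.exists_norm_digamma_sub_log_le_of_pos
      (a := 1 / 4) (by norm_num)
  have hlow : ∀ t : ℝ, Real.log (1 + |t / 2|) - C ≤ reDigammaQuarter t := by
    intro t
    have h := hC (t / 2)
    have e : ((1 / 4 : ℝ) : ℂ) + ((t / 2 : ℝ) : ℂ) * I = 1 / 4 + t / 2 * I := by push_cast; ring
    rw [e] at h
    have hre := (Complex.abs_re_le_norm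
      (Complex.digamma (1 / 4 + t / 2 * I) - (Real.log (1 + |t / 2|) : ℂ))).trans h
    rw [Complex.sub_re, Complex.ofReal_re] at hre
    unfold reDigammaQuarter
    linarith [(abs_le.1 hre).1]
  refine ⟨2 * Real.exp (L + C), by positivity, fun t ht ↦ ?_⟩
  refine le_trans ?_ (hlow t)
  rw [le_sub_iff_add_le, Real.le_log_iff_exp_le (by positivity)]
  rw [abs_div, abs_two]
  linarith

/-! ## A grid on `[-T, T]` -/

/-- Every point of `[-T, T]` is within mesh `2T/N` of a grid point `-T + j (2T/N)`, `j ≤ N`. [folklore] -/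
theorem exists_grid_point_near {T : ℝ} (hT : 0 < T) {N : ℕ} (hN : 1 ≤ N) {t : ℝ}
    (ht : t ∈ Icc (-T) T) :
    ∃ j : Fin (N + 1), |t - (-T + (j : ℕ) * (2 * T / N))| ≤ 2 * T / N := by
  have hNpos : (0 : ℝ) < N := by exact_mod_cast hN
  set hm : ℝ := 2 * T / N with hm_def
  have hmpos : 0 < hm := by positivity
  have h0 : 0 ≤ (t + T) / hm := div_nonneg (by linarith [ht.1]) hmpos.le
  set k : ℕ := ⌊(t + T) / hm⌋₊ with hk
  have hk1 : (k : ℝ) ≤ (t + T) / hm := Nat.floor_le h0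
  have hk2 : (t + T) / hm < k + 1 := Nat.lt_floor_add_one _
  have hkN : k ≤ N := by
    have h1 : (t + T) / hm ≤ N := by
      rw [div_le_iff₀ hmpos, hm_def]
      field_simp
      linarith [ht.2]
    exact_mod_cast hk1.trans h1
  refine ⟨⟨k, Nat.lt_succ_of_le hkN⟩, ?_⟩
  simp only
  have e1 : (k : ℝ) * hm ≤ t + T := by rwa [← le_div_iff₀ hmpos]
  have e2 : t + T < (k + 1) * hm := by rwa [← div_lt_iff₀ hmpos]
  rw [abs_le]
  constructor <;> nlinarith

/-! ## An `ε`-net criterion -/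

universe u in
/-- **Total boundedness from finitely many bounded coordinates.** If for every `ε > 0` there are
finitely many complex "coordinates" `F : α → (Fin N → ℂ)`, bounded on `s`, such that two points of
`s` whose coordinates are `δ`-close are `ε`-close, then `s` is totally bounded (the coordinates of
`s` form a bounded, hence totally bounded, subset of `ℂ^N`). [folklore] -/
theorem totallyBounded_of_fin_coord {α : Type u} [PseudoMetricSpace α] {s : Set α}
    (H : ∀ ε > (0 : ℝ), ∃ (N : ℕ) (R δ : ℝ), 0 < δ ∧ ∃ F : α → (Fin N → ℂ),
      (∀ x ∈ s, ‖F x‖ ≤ R) ∧ ∀ x ∈ s, ∀ y ∈ s, ‖F x - F y‖ < δ → dist x y < ε) :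
    TotallyBounded s := by
  refine Metric.totallyBounded_of_finite_discretization fun ε hε ↦ ?_
  obtain ⟨N, R, δ, hδ, F, hFR, hF⟩ := H ε hε
  obtain ⟨t, htf, hcover⟩ := Metric.totallyBounded_iff.1
    (isCompact_closedBall (0 : Fin N → ℂ) R).totallyBounded (δ / 2) (half_pos hδ)
  haveI : Fintype t := htf.fintype
  have hmem : ∀ x : s, ∃ y : t, F x ∈ Metric.ball (y : Fin N → ℂ) (δ / 2) := by
    intro x
    have hx : F x ∈ Metric.closedBall (0 : Fin N → ℂ) R :=
      mem_closedBall_zero_iff.2 (hFR x x.2)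
    obtain ⟨y, hy, hxy⟩ := Set.mem_iUnion₂.1 (hcover hx)
    exact ⟨⟨y, hy⟩, hxy⟩
  choose G hG using hmem
  refine ⟨ULift.{u} t, inferInstance, fun x ↦ ULift.up (G x), fun x y hxy ↦ ?_⟩
  have hxy' : G x = G y := ULift.up_inj.1 hxy
  refine hF x x.2 y y.2 ?_
  have h1 := hG x
  have h2 := hG y
  rw [← hxy'] at h2
  rw [Metric.mem_ball] at h1 h2
  calc ‖F x - F y‖ = dist (F x) (F y) := (dist_eq_norm _ _).symm
    _ ≤ dist (F x) (G x) + dist (F y) (G x) := dist_triangle_right _ _ _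
    _ < δ / 2 + δ / 2 := add_lt_add h1 h2
    _ = δ := add_halves δ


/-! ## The archimedean integral is controlled by the form (CCM25, proof of Thm. 3.6, first step) -/

/-- **The polar and prime contributions are bounded** (CCM25, proof of Thm. 3.6: "the contribution
of the non-archimedean primes to the operator `A_λ` is bounded as well as the contribution of the
evaluation of the Fourier transform at the poles"; Bombieri 2000 §4 Lemma 3): for a test function
`g` with `tsupport g ⊆ [-a, a]`,
`(1/2π) ∫ |ĝ(1/2+it)|² Re ψ(1/4+it/2) dt ≤ Re Q(g) + (2(sinh a − a) + 2 Σ_{n ≤ e^{2a}} Λ(n)/√n + log π) ‖g‖₂²`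
(polar term `≥ −2(sinh a − a)‖g‖₂²` by `Yoshida1992_polar_lower_bound`, prime term `≤ 2‖g‖₂² Σ Λ(n)/√n`). [cite: ConnesConsaniMoscovici2025, Thm. 3.6 (proof, first paragraph)] -/
theorem weilArchIntegral_le_weilQuadratic_re (hg : IsWeilTest g) {a : ℝ}
    (hsupp : tsupport g ⊆ Icc (-a) a) :
    1 / (2 * π) * ∫ t : ℝ, ‖weilMellin g (1 / 2 + t * I)‖ ^ 2 * reDigammaQuarter t ≤
      (weilQuadratic g).re +
        (2 * (Real.sinh a - a)
          + 2 * (∑ n ∈ Finset.range (⌊Real.exp (2 * a)⌋₊ + 1), (Λ n : ℝ) / Real.sqrt n)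
          + Real.log π) * ∫ t : ℝ, ‖g t‖ ^ 2 := by
  set N2 : ℝ := ∫ t : ℝ, ‖g t‖ ^ 2 with hN2
  set S : ℝ := ∑ n ∈ Finset.range (⌊Real.exp (2 * a)⌋₊ + 1), (Λ n : ℝ) / Real.sqrt n with hS
  set k : ℝ → ℂ := weilConv g (weilReflect g) with hk
  have hkt : IsWeilTest k := hg.weilConv hg.weilReflect
  have hks : tsupport k ⊆ Icc (-(2 * a)) (2 * a) :=
    tsupport_weilConv_weilReflect_subset hg.2 hsupp
  -- the polar term (Yoshida (6.2)–(6.3))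
  have hpol : (weilPolarTerm k).re = 2 * (weilMellin g 0 * conj (weilMellin g 1)).re := by
    rw [hk, weilPolarTerm_weilConv_weilReflect hg, Complex.ofReal_re]
  have hpol_ge : -(2 * (Real.sinh a - a)) * N2 ≤ (weilPolarTerm k).re := by
    rw [hpol]
    exact Yoshida1992_polar_lower_bound hg hsupp
  -- the prime term (Bombieri's Lemmas 2–3)
  have hprime : (weilPrimeTerm k).re ≤ 2 * N2 * S :=
    (Complex.re_le_norm _).trans
      (norm_weilPrimeTerm_le_of_tsupport_subset hkt.1.continuous hks
        (fun t ↦ norm_weilConv_weilReflect_le hg t))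
  -- the archimedean term
  set A : ℝ := ∫ t : ℝ, ‖weilMellin g (1 / 2 + t * I)‖ ^ 2 * reDigammaQuarter t with hA
  have harch : (weilArchTerm k).re = 1 / (2 * π) * A - N2 * Real.log π := by
    have e : weilArchTerm k = ((1 / (2 * π) * A - N2 * Real.log π : ℝ) : ℂ) := by
      unfold weilArchTerm
      rw [hk, weilArchIntegral_weilConv_weilReflect hg, weilConv_weilReflect_apply_zero]
      push_cast
      unfold reDigammaQuarter at hA
      rw [← hA, ← hN2]
    rw [e, Complex.ofReal_re]
  -- assembly
  have hQ : (weilQuadratic g).re =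
      (weilPolarTerm k).re - (weilPrimeTerm k).re + (weilArchTerm k).re := by
    simp only [weilQuadratic, weilFunctional, hk, Complex.add_re, Complex.sub_re]
  rw [hQ, harch]
  nlinarith [hpol_ge, hprime]

/-! ## The `ε`-net estimate (CCM25, proof of Thm. 3.6: tail (3.26) + finite net on `|t| ≤ T`) -/

/-- **Distance estimate between two normalised test functions on the window** (the assembly step of
CCM25's proof of Thm. 3.6: `‖f − f_j‖² = ∫_{|t|≤T} |f̂ − f̂_j|² dt/2π + ∫_{|t|≥T} |f̂ − f̂_j|² dt/2π`, the
tail being small by (3.26) because the weight `ρ → ∞`): if `Re ψ(1/4 + it/2) ≥ L > ψ(1/4)` for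
`|t| ≥ T`, the weighted integrals `∫ |ĝᵢ(1/2+it)|² Re ψ(1/4+it/2) dt ≤ A` and
`|ĝ₁ − ĝ₂| ≤ D` on `[−T, T]`, then
`2π ‖g₁ − g₂‖₂² ≤ 2T D² + (2/(L − ψ(1/4))) (2A − 4π ψ(1/4))`. [cite: ConnesConsaniMoscovici2025, Thm. 3.6 (proof, eq. (3.26) and last display)] -/
theorem two_pi_mul_integral_norm_sub_sq_le {T L D A : ℝ} (hT : 0 < T)
    (hL : reDigammaQuarter 0 < L) (hLT : ∀ t : ℝ, T ≤ |t| → L ≤ reDigammaQuarter t)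
    {g₁ g₂ : ℝ → ℂ} (hg₁ : IsWeilTest g₁) (hg₂ : IsWeilTest g₂)
    (hn₁ : ∫ t : ℝ, ‖g₁ t‖ ^ 2 = 1) (hn₂ : ∫ t : ℝ, ‖g₂ t‖ ^ 2 = 1)
    (hA₁ : ∫ t : ℝ, ‖weilMellin g₁ (1 / 2 + t * I)‖ ^ 2 * reDigammaQuarter t ≤ A)
    (hA₂ : ∫ t : ℝ, ‖weilMellin g₂ (1 / 2 + t * I)‖ ^ 2 * reDigammaQuarter t ≤ A)
    (hclose : ∀ t ∈ Icc (-T) T,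
      ‖weilMellin g₁ (1 / 2 + t * I) - weilMellin g₂ (1 / 2 + t * I)‖ ≤ D) :
    2 * π * ∫ t : ℝ, ‖g₁ t - g₂ t‖ ^ 2 ≤
      2 * T * D ^ 2 + 2 / (L - reDigammaQuarter 0) * (2 * A - 4 * π * reDigammaQuarter 0) := by
  set ρ₀ : ℝ := reDigammaQuarter 0 with hρ₀
  set H₁ : ℝ → ℂ := fun t ↦ weilMellin g₁ (1 / 2 + t * I) with hH₁
  set H₂ : ℝ → ℂ := fun t ↦ weilMellin g₂ (1 / 2 + t * I) with hH₂
  have hsub : IsWeilTest (g₁ - g₂) := hg₁.sub_test hg₂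
  -- Plancherel
  have hP : ∫ t : ℝ, ‖weilMellin (g₁ - g₂) (1 / 2 + t * I)‖ ^ 2 =
      2 * π * ∫ t : ℝ, ‖g₁ t - g₂ t‖ ^ 2 := by
    rw [integral_norm_sq_weilMellin_half_line hsub]
    simp [weilNorm2Sq]
  have hP₁ : ∫ t : ℝ, ‖H₁ t‖ ^ 2 = 2 * π := by
    simp only [hH₁]
    rw [integral_norm_sq_weilMellin_half_line hg₁, weilNorm2Sq, hn₁, mul_one]
  have hP₂ : ∫ t : ℝ, ‖H₂ t‖ ^ 2 = 2 * π := by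
    simp only [hH₂]
    rw [integral_norm_sq_weilMellin_half_line hg₂, weilNorm2Sq, hn₂, mul_one]
  -- the pointwise bound
  have hLρ : 0 < L - ρ₀ := sub_pos.2 hL
  set c : ℝ := 2 / (L - ρ₀) with hc
  have hc0 : 0 < c := div_pos two_pos hLρ
  have hpt : ∀ t : ℝ, ‖weilMellin (g₁ - g₂) (1 / 2 + t * I)‖ ^ 2 ≤
      (Icc (-T) T).indicator (fun _ ↦ D ^ 2) t +
        c * (‖H₁ t‖ ^ 2 * (reDigammaQuarter t - ρ₀) + ‖H₂ t‖ ^ 2 * (reDigammaQuarter t - ρ₀)) := by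
    intro t
    rw [weilMellin_sub_of_isWeilTest hg₁ hg₂]
    have hρ : ρ₀ ≤ reDigammaQuarter t := reDigammaQuarter_zero_le t
    have hnn : 0 ≤ c * (‖H₁ t‖ ^ 2 * (reDigammaQuarter t - ρ₀) +
        ‖H₂ t‖ ^ 2 * (reDigammaQuarter t - ρ₀)) :=
      mul_nonneg hc0.le (add_nonneg (mul_nonneg (sq_nonneg _) (sub_nonneg.2 hρ))
        (mul_nonneg (sq_nonneg _) (sub_nonneg.2 hρ)))
    by_cases ht : t ∈ Icc (-T) T
    · rw [indicator_of_mem ht]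
      have h1 : ‖H₁ t - H₂ t‖ ^ 2 ≤ D ^ 2 := pow_le_pow_left₀ (norm_nonneg _) (hclose t ht) 2
      change ‖H₁ t - H₂ t‖ ^ 2 ≤ _
      linarith
    · rw [indicator_of_notMem ht, zero_add]
      have hTt : T ≤ |t| := by
        simp only [mem_Icc, not_and_or, not_le] at ht
        rcases ht with h | h
        · rw [abs_of_neg (by linarith)]; linarith
        · exact h.le.trans (le_abs_self t)
      have hLt : L ≤ reDigammaQuarter t := hLT t hTt
      have hcw : 2 ≤ c * (reDigammaQuarter t - ρ₀) := by
        rw [hc, div_mul_eq_mul_div, le_div_iff₀ hLρ]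
        linarith
      have hpar : ‖H₁ t - H₂ t‖ ^ 2 ≤ 2 * ‖H₁ t‖ ^ 2 + 2 * ‖H₂ t‖ ^ 2 := by
        have h' : ‖H₁ t - H₂ t‖ ^ 2 ≤ (‖H₁ t‖ + ‖H₂ t‖) ^ 2 :=
          pow_le_pow_left₀ (norm_nonneg _) (norm_sub_le (H₁ t) (H₂ t)) 2
        nlinarith [sq_nonneg (‖H₁ t‖ - ‖H₂ t‖)]
      change ‖H₁ t - H₂ t‖ ^ 2 ≤ _
      nlinarith [sq_nonneg ‖H₁ t‖, sq_nonneg ‖H₂ t‖]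
  -- integrability
  have hint_lhs : Integrable fun t : ℝ ↦ ‖weilMellin (g₁ - g₂) (1 / 2 + t * I)‖ ^ 2 :=
    integrable_norm_sq_weilMellin_half_line hsub
  have hint_ind : Integrable ((Icc (-T) T).indicator fun _ : ℝ ↦ D ^ 2) :=
    (continuous_const.continuousOn.integrableOn_compact isCompact_Icc).integrable_indicator
      measurableSet_Icc
  have hint_w : ∀ {f : ℝ → ℂ}, IsWeilTest f → Integrable fun t : ℝ ↦
      ‖weilMellin f (1 / 2 + t * I)‖ ^ 2 * (reDigammaQuarter t - ρ₀) := by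
    intro f hf
    have h := (integrable_norm_sq_weilMellin_mul_reDigammaQuarter hf).sub
      ((integrable_norm_sq_weilMellin_half_line hf).mul_const ρ₀)
    refine h.congr (Eventually.of_forall fun t ↦ ?_)
    simp only [Pi.sub_apply]
    ring
  have hint_w₁ : Integrable fun t : ℝ ↦ ‖H₁ t‖ ^ 2 * (reDigammaQuarter t - ρ₀) := hint_w hg₁
  have hint_w₂ : Integrable fun t : ℝ ↦ ‖H₂ t‖ ^ 2 * (reDigammaQuarter t - ρ₀) := hint_w hg₂
  have hint_w12 : Integrable fun t : ℝ ↦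
      ‖H₁ t‖ ^ 2 * (reDigammaQuarter t - ρ₀) + ‖H₂ t‖ ^ 2 * (reDigammaQuarter t - ρ₀) :=
    hint_w₁.add hint_w₂
  have hint_cw : Integrable fun t : ℝ ↦
      c * (‖H₁ t‖ ^ 2 * (reDigammaQuarter t - ρ₀) + ‖H₂ t‖ ^ 2 * (reDigammaQuarter t - ρ₀)) :=
    hint_w12.const_mul c
  have hint_rhs : Integrable fun t : ℝ ↦ (Icc (-T) T).indicator (fun _ ↦ D ^ 2) t +
      c * (‖H₁ t‖ ^ 2 * (reDigammaQuarter t - ρ₀) + ‖H₂ t‖ ^ 2 * (reDigammaQuarter t - ρ₀)) :=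
    hint_ind.add hint_cw
  have hmono := integral_mono hint_lhs hint_rhs hpt
  rw [integral_add hint_ind hint_cw, integral_const_mul, integral_add hint_w₁ hint_w₂] at hmono
  -- evaluate the pieces
  have hI : ∫ t : ℝ, (Icc (-T) T).indicator (fun _ : ℝ ↦ D ^ 2) t = 2 * T * D ^ 2 := by
    rw [integral_indicator measurableSet_Icc, setIntegral_const, smul_eq_mul,
      Real.volume_real_Icc_of_le (by linarith)]
    ring
  have hW : ∀ {f : ℝ → ℂ}, IsWeilTest f → (∫ t : ℝ, ‖f t‖ ^ 2 = 1) →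
      ∫ t : ℝ, ‖weilMellin f (1 / 2 + t * I)‖ ^ 2 * (reDigammaQuarter t - ρ₀) =
        (∫ t : ℝ, ‖weilMellin f (1 / 2 + t * I)‖ ^ 2 * reDigammaQuarter t) - 2 * π * ρ₀ := by
    intro f hf hn
    simp_rw [mul_sub]
    rw [integral_sub (integrable_norm_sq_weilMellin_mul_reDigammaQuarter hf)
      ((integrable_norm_sq_weilMellin_half_line hf).mul_const ρ₀), integral_mul_const,
      integral_norm_sq_weilMellin_half_line hf, weilNorm2Sq, hn, mul_one]
  have hW₁ := hW hg₁ hn₁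
  have hW₂ := hW hg₂ hn₂
  change ∫ t : ℝ, ‖weilMellin (g₁ - g₂) (1 / 2 + t * I)‖ ^ 2 ≤
    (∫ t : ℝ, (Icc (-T) T).indicator (fun _ : ℝ ↦ D ^ 2) t) +
      c * ((∫ t : ℝ, ‖weilMellin g₁ (1 / 2 + t * I)‖ ^ 2 * (reDigammaQuarter t - ρ₀)) +
        ∫ t : ℝ, ‖weilMellin g₂ (1 / 2 + t * I)‖ ^ 2 * (reDigammaQuarter t - ρ₀)) at hmono
  rw [hI, hW₁, hW₂, hP] at hmono
  have hlast : c * ((∫ t : ℝ, ‖weilMellin g₁ (1 / 2 + t * I)‖ ^ 2 * reDigammaQuarter t) - 2 * π * ρ₀ +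
      ((∫ t : ℝ, ‖weilMellin g₂ (1 / 2 + t * I)‖ ^ 2 * reDigammaQuarter t) - 2 * π * ρ₀)) ≤
      c * (2 * A - 4 * π * ρ₀) :=
    mul_le_mul_of_nonneg_left (by linarith) hc0.le
  linarith

/-! ## Theorem 3.6 -/

/-- **Discharge of `ConnesConsaniMoscovici2025_thm_3_6`** (Connes–Consani–Moscovici 2025, Thm. 3.6
with Prop. 3.5 (1)⇔(4): the form-norm embedding of the semilocal Weil form is compact, i.e. `A_λ`
has discrete spectrum). The proof follows the paper: the polar and prime contributions are bounded
(`weilArchIntegral_le_weilQuadratic_re`), so a bound on `Re Q(gₙ)` bounds the weighted integrals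
`∫ |ĝₙ(1/2+it)|² Re ψ(1/4+it/2) dt`; the weight tends to `+∞` ((3.24),
`exists_le_reDigammaQuarter_of_le_abs`), which makes the Fourier tails `∫_{|t|≥T} |ĝₙ|²` uniformly
small ((3.26)); on `|t| ≤ T` the transforms `ĝₙ(1/2+it)` are uniformly bounded and uniformly
Lipschitz (the window is compact), so finitely many grid values determine `gₙ` up to `ε` in `L²`
(Plancherel) — this replaces the compactness of `P̂_T P_L` used in the paper; hence `{gₙ}` is totally
bounded in `L²(ℝ)`, its closure is compact, and a subsequence converges. [cite: ConnesConsaniMoscovici2025, Thm. 3.6 and Prop. 3.5] -/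
theorem ConnesConsaniMoscovici2025_thm_3_6_holds : ConnesConsaniMoscovici2025_thm_3_6 := by
  intro a ha g hg hB
  obtain ⟨B, hB⟩ := hB
  have hB' : ∀ n, (weilQuadratic (g n)).re ≤ B := fun n ↦ hB ⟨n, rfl⟩
  -- constants
  set ρ₀ : ℝ := reDigammaQuarter 0 with hρ₀
  set K : ℝ := 2 * (Real.sinh a - a)
    + 2 * (∑ n ∈ Finset.range (⌊Real.exp (2 * a)⌋₊ + 1), (Λ n : ℝ) / Real.sqrt n)
    + Real.log π with hK
  set Abd : ℝ := 2 * π * (B + K) with hAbd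
  have hπ2 : 0 < 2 * π := by positivity
  have hA : ∀ n, ∫ t : ℝ, ‖weilMellin (g n) (1 / 2 + t * I)‖ ^ 2 * reDigammaQuarter t ≤ Abd := by
    intro n
    have h := weilArchIntegral_le_weilQuadratic_re (hg n).1 (hg n).2.1
    rw [(hg n).2.2, mul_one, div_mul_eq_mul_div, one_mul, div_le_iff₀ hπ2] at h
    have := hB' n
    rw [hAbd]
    nlinarith [Real.pi_pos]
  set Λ₁ : ℝ := a * Real.sqrt (2 * a) with hΛ₁
  have hΛ₁pos : 0 < Λ₁ := by positivity
  have hN1g : ∀ n, weilNorm1 (g n) ≤ Real.sqrt (2 * a) := fun n ↦ by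
    have h := (le_abs_self _).trans (Real.abs_le_sqrt (weilNorm1_sq_le (hg n).1 ha (hg n).2.1))
    rwa [weilNorm2Sq, (hg n).2.2, mul_one] at h
  have hsup : ∀ n (t : ℝ), ‖weilMellin (g n) (1 / 2 + t * I)‖ ≤ Real.sqrt (2 * a) := fun n t ↦ by
    have h := norm_weilMellin_half_line_le_sqrt (hg n).1 ha (hg n).2.1 t
    rwa [(hg n).2.2, mul_one] at h
  have hlip : ∀ n (t s : ℝ),
      ‖weilMellin (g n) (1 / 2 + t * I) - weilMellin (g n) (1 / 2 + s * I)‖ ≤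
      Λ₁ * |t - s| := fun n t s ↦ by
    refine (norm_weilMellin_half_line_sub_le (hg n).1 (hg n).2.1 t s).trans ?_
    rw [hΛ₁, mul_assoc, mul_assoc]
    refine mul_le_mul_of_nonneg_left ?_ ha.le
    rw [mul_comm]
    exact mul_le_mul_of_nonneg_right (hN1g n) (abs_nonneg _)
  -- the `L²` classes
  have hgm : ∀ n, MemLp (g n) 2 (volume : Measure ℝ) := fun n ↦
    (hg n).1.1.continuous.memLp_of_hasCompactSupport (hg n).1.2
  set x : ℕ → Lp ℂ 2 (volume : Measure ℝ) := fun n ↦ (hgm n).toLp (g n) with hx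
  have hdist : ∀ n m, dist (x n) (x m) = Real.sqrt (∫ t : ℝ, ‖g n t - g m t‖ ^ 2) := by
    intro n m
    rw [Lp.dist_def, eLpNorm_congr_ae ((hgm n).coeFn_toLp.sub (hgm m).coeFn_toLp),
      eLpNorm_two_eq_ofReal_sqrt ((hgm n).sub (hgm m)), ENNReal.toReal_ofReal (Real.sqrt_nonneg _)]
    rfl
  -- total boundedness
  have hS : TotallyBounded (Set.range x) := by
    refine totallyBounded_of_fin_coord fun ε hε ↦ ?_
    set M₀ : ℝ := 2 * Abd - 4 * π * ρ₀ with hM₀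
    set L : ℝ := ρ₀ + 1 + 4 * |M₀| / (π * ε ^ 2) with hL
    have hLρ : ρ₀ < L := by
      have : 0 ≤ 4 * |M₀| / (π * ε ^ 2) := by positivity
      rw [hL]; linarith
    obtain ⟨T, hT, hLT⟩ := exists_le_reDigammaQuarter_of_le_abs L
    set D₀ : ℝ := ε * Real.sqrt (π / (4 * T)) with hD₀
    have hD₀pos : 0 < D₀ := by positivity
    set N : ℕ := ⌈8 * Λ₁ * T / D₀⌉₊ + 1 with hN
    have hN1 : 1 ≤ N := Nat.le_add_left 1 _
    have hNpos : (0 : ℝ) < N := by exact_mod_cast hN1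
    have hNr : 8 * Λ₁ * T / D₀ ≤ N := by
      rw [hN]; push_cast
      linarith [Nat.le_ceil (8 * Λ₁ * T / D₀)]
    set η : ℝ := 2 * T / N with hη
    have hη0 : 0 ≤ η := by positivity
    have hmesh : 2 * Λ₁ * η ≤ D₀ / 2 := by
      have h8 : 8 * Λ₁ * T ≤ N * D₀ := (div_le_iff₀ hD₀pos).1 hNr
      rw [hη, show 2 * Λ₁ * (2 * T / N) = 4 * Λ₁ * T / N by ring, div_le_iff₀ hNpos]
      linarith
    -- grid points and coordinates
    set tg : Fin (N + 1) → ℝ := fun j ↦ -T + (j : ℕ) * η with htg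
    set F : Lp ℂ 2 (volume : Measure ℝ) → (Fin (N + 1) → ℂ) :=
      fun f j ↦ ∫ y : ℝ, (f : ℝ → ℂ) y * cexp ((tg j : ℂ) * I * y) with hF
    have hFx : ∀ n j, F (x n) j = weilMellin (g n) (1 / 2 + tg j * I) := by
      intro n j
      rw [weilMellin_half_line_eq]
      exact integral_congr_ae (by
        filter_upwards [(hgm n).coeFn_toLp] with y hy
        rw [hy])
    refine ⟨N + 1, Real.sqrt (2 * a), D₀ / 2, half_pos hD₀pos, F, ?_, ?_⟩
    · rintro _ ⟨n, rfl⟩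
      exact (pi_norm_le_iff_of_nonneg (Real.sqrt_nonneg _)).2 fun j ↦ by
        rw [hFx]; exact hsup n (tg j)
    · rintro _ ⟨n, rfl⟩ _ ⟨m, rfl⟩ hδ
      have hgrid : ∀ j, ‖weilMellin (g n) (1 / 2 + tg j * I) - weilMellin (g m) (1 / 2 + tg j * I)‖
          < D₀ / 2 := fun j ↦ by
        rw [← hFx n j, ← hFx m j]
        exact (norm_le_pi_norm (F (x n) - F (x m)) j).trans_lt hδ
      have hclose : ∀ t ∈ Icc (-T) T,
          ‖weilMellin (g n) (1 / 2 + t * I) - weilMellin (g m) (1 / 2 + t * I)‖ ≤ D₀ := by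
        intro t ht
        obtain ⟨j, hj⟩ := exists_grid_point_near hT hN1 ht
        change |t - tg j| ≤ η at hj
        have h1 := hlip n t (tg j)
        have h2 := hgrid j
        have h3 := hlip m (tg j) t
        rw [abs_sub_comm] at h3
        have h4 : Λ₁ * |t - tg j| ≤ Λ₁ * η := mul_le_mul_of_nonneg_left hj hΛ₁pos.le
        have e1 := norm_sub_le_norm_sub_add_norm_sub (weilMellin (g n) (1 / 2 + t * I))
          (weilMellin (g n) (1 / 2 + tg j * I)) (weilMellin (g m) (1 / 2 + t * I))
        have e2 := norm_sub_le_norm_sub_add_norm_sub (weilMellin (g n) (1 / 2 + tg j * I))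
          (weilMellin (g m) (1 / 2 + tg j * I)) (weilMellin (g m) (1 / 2 + t * I))
        linarith
      have key := two_pi_mul_integral_norm_sub_sq_le hT hLρ hLT (hg n).1 (hg m).1
        (hg n).2.2 (hg m).2.2 (hA n) (hA m) hclose
      have h1 : 2 * T * D₀ ^ 2 = π * ε ^ 2 / 2 := by
        rw [hD₀, mul_pow, Real.sq_sqrt (by positivity)]
        field_simp
        ring
      have hLsub : L - ρ₀ = 1 + 4 * |M₀| / (π * ε ^ 2) := by rw [hL]; ring
      have hpos : 0 < L - ρ₀ := sub_pos.2 hLρ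
      have hπε : 0 < π * ε ^ 2 := by positivity
      have h2 : 2 / (L - ρ₀) * M₀ ≤ π * ε ^ 2 / 2 :=
        calc 2 / (L - ρ₀) * M₀ ≤ 2 / (L - ρ₀) * |M₀| :=
              mul_le_mul_of_nonneg_left (le_abs_self _) (by positivity)
          _ ≤ π * ε ^ 2 / 2 := by
              rw [div_mul_eq_mul_div, div_le_iff₀ hpos, hLsub]
              have e : π * ε ^ 2 / 2 * (1 + 4 * |M₀| / (π * ε ^ 2)) = π * ε ^ 2 / 2 + 2 * |M₀| := by
                field_simp
                ring
              rw [e]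
              linarith
      have h3 : ∫ t : ℝ, ‖g n t - g m t‖ ^ 2 < ε ^ 2 := by nlinarith [Real.pi_pos]
      rw [hdist]
      exact (Real.sqrt_lt' hε).2 h3
  -- a convergent subsequence
  obtain ⟨u, -, φ, hφ, hconv⟩ :=
    (hS.closure.isCompact_of_isClosed isClosed_closure).tendsto_subseq
      (x := x) fun n ↦ subset_closure ⟨n, rfl⟩
  refine ⟨u, Lp.memLp u, φ, hφ, ?_⟩
  have hI0 : ∀ n, 0 ≤ ∫ t : ℝ, ‖g (φ n) t - u t‖ ^ 2 := fun n ↦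
    integral_nonneg fun _ ↦ by positivity
  have hdu : ∀ n, dist (x n) u = Real.sqrt (∫ t : ℝ, ‖g n t - u t‖ ^ 2) := by
    intro n
    rw [Lp.dist_def, eLpNorm_congr_ae ((hgm n).coeFn_toLp.sub EventuallyEq.rfl),
      eLpNorm_two_eq_ofReal_sqrt ((hgm n).sub (Lp.memLp u)),
      ENNReal.toReal_ofReal (Real.sqrt_nonneg _)]
    rfl
  have hd : Tendsto (fun n ↦ dist (x (φ n)) u) atTop (𝓝 0) :=
    tendsto_iff_dist_tendsto_zero.1 hconv
  have h2 := hd.pow 2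
  rw [zero_pow two_ne_zero] at h2
  refine h2.congr fun n ↦ ?_
  rw [hdu, Real.sq_sqrt (hI0 n)]

end Literature.NumberTheory.LFunctions

end
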